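/-
Copyright (c) 2026 the pub-hodgecm-mathlib formalisation cell (harness21).  Prover seat hodgecm-mathlib-K2Liu-p08 (g4), Track B «K2-LIT» ∕ hLiu418
#184♮, socket #42S `sig_K2LiuStandardSectionSpanBySWGenerators`, organ S4, brick (S4-Kfin) (LEAD F0P6-plan (g14) BATCH #2 10:50:47Z; consumer (S4-asm)
K2Liu-p03 (g7)).  2026-09-04.  KERNEL: theorems only.
-/
import Summits.HodgeConjecture.HodgeConjecture.Theorems.K2LiuRigidityDomainKFiniteConverse   -- ★ U2f ⇐ `exists_archStable_of_finiteDimensional_span_orbit` (+ ★ U2f ⇒, ★ `…_of_isStd`, ★ D-pin)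
import Literature.NumberTheory.Automorphic.FiniteAdeleFactorizable                          -- ★ `LocalSBFamily`, `piProdSB` (G7's restricted pure tensors `⊗_v Y_v`)
import Mathlib.LinearAlgebra.Dual.Lemmas
import HarnessLib

/-!
# K2_Liu road (hLiu418 = stmt-HodgeConjecture-24832), socket #42S organ S4, brick (S4-Kfin): THE `K`-FINITENESS CLAUSE `_hΦ` OF #42S (a)
# FOR PURE TENSORS `Φ = Φ_∞ ⊗ Φ_f` — IT SEES ONLY THE ARCHIMEDEAN FACTOR

Cell `pub/hodgecm-mathlib` (D-0151), Track B, build stream 29.  The binder `_hΦ i` of U6 :884 (#42S clause (a), = #42F′'s `_hΦ` :729 with the index applied) reads, for a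
STANDARD Iwasawa datum `𝒦` of the small group `H = U(𝔻)(𝔸)` and the twisted Siegel–Weil generator's Schwartz datum `Φ ∈ 𝒮(𝔸^{n′+n′})` of the BIG datum
`(e′, dV, tensorFrame dW eW dV′)`:  «the span of `{ω(s^B(k ⊗ 1)) Φ : k ∈ 𝒦.K}` is finite-dimensional», `s^B` the `χ_b`-normalised doubled Weil representation (bytes: the concrete
★ `doubledWeilRep … χ_b`; every theorem here is stated for ANY `s^B` with ★ `IsDoubledWeilRep … χ_b s^B` and specialised to the bytes by ★ `isDoubledWeilRep_doubledWeilRep`).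
The (S4-asm) assembler (K2Liu-p03) builds, per COHERENT pure term, ONE pure tensor `Φ = Φ_∞ ⊗ (⊗_{v∈S} Φ_v) ⊗ (⊗_{v∉S} 𝟙_v) = E(Φ_∞ ⊗ piProdSB Y)` (G7's currency ★ p859460) and
owes `_hΦ` for it.  THIS FILE: the finite factor costs NOTHING (★ U2f ⇒ p858720 `K2LiuRigidityDomainKFinite`: every `Φ_f` is fixed by a principal congruence level, ★
`K2LiuDoubledWeilRepFinHalf`), so `_hΦ` of a pure tensor is a property of its ARCHIMEDEAN factor alone — in the two currencies a supplier of arch data can hand over: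

* §0 generic linear algebra: `mem_of_tmul_mem_span_tmul` (`m ⊗ x ∈ span{w ⊗ y : w ∈ W}`, `x ≠ 0` ⇒ `m ∈ W`, by a functional `φ` with `φ x = 1` and `(1 ⊗ φ)`);
  `finiteDimensional_span_range_of_mem_span` (orbit spans under ANY family of linear maps: the vectors with finite-dimensional orbit span form a SUBSPACE).
* §1 (currency (α) = Road I's arch datum of record `(V, harch, Φ_∞ ∈ V)`, ★ `K2LiuResidueMapLinear` ∕ ★ `K2LiuFirstTermIdentityPureTensorReduction`):
  **`finiteDimensional_span_orbit_tmul`** — `𝒦.IsStd`, `V ≤ 𝓢((L⁺ ⊗ ℝ)^{n′+n′})` finite-dimensional and stabilised slot-wise by the purely archimedean `(a_∞, 1) ∈ 𝒦.K` (the `harch` of ★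
  `K2LiuTensorEmbArchFinParts.hV_of_arch`), `Φ_∞ ∈ V`, `Φ_f` ARBITRARY ⇒ `_hΦ` for `E(Φ_∞ ⊗ Φ_f)`; `…_tmul_piProdSB` (G7's `Φ_∞ ⊗ ⊗_v Y_v`); **`…_tmul_doubledWeilRep`** (the BYTES of U6 :884).
* §2 (currency (γ), operator-free): **`exists_archStable_mem_of_finiteDimensional_span_orbit_tmul`** — for ANY `𝒦`: if ONE pure tensor `E(Φ_∞ ⊗ f₀)` with `f₀ ≠ 0` satisfies `_hΦ`, then
  `Φ_∞` lies in a finite-dimensional arch-stable `V` (★ U2f ⇐ + §0); hence **`finiteDimensional_span_orbit_tmul_of_tmul`** (`𝒦.IsStd`): `_hΦ` for `E(Φ_∞ ⊗ f₀)`, `f₀ ≠ 0` ⇒ `_hΦ` for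
  `E(Φ_∞ ⊗ Φ_f)` for EVERY `Φ_f` — one finite test function certifies all finite components; `…_of_tmul_doubledWeilRep` (bytes).
* §3 closure for the assembler's finite sums: **`finiteDimensional_span_orbit_of_mem_span`** — `_hΦ` holds on the span of any set on which it holds (bytes over `s^B`).

No definition, no instance, no notation, no named fact, no `sorry`; axioms ⊆ {propext, Classical.choice, Quot.sound}.  HONEST LABEL: HC_CM is proved only modulo the 7 printed
citations (2 remaining named inputs: hLiu418 = stmt-HodgeConjecture-24832, h413 = stmt-HodgeConjecture-24833) until rung 0 closes; `--supports stmt-HodgeConjecture-24832 --as helper`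
file, count-neutral; it closes no socket.
References: [HarrisKudlaSweet1996] M. Harris, S. Kudla, W. J. Sweet, J. AMS 9 (1996), §1 (1.15)–(1.17) (`K`-finite Siegel–Weil sections of factorizable `Φ`); [Weil1964] A. Weil,
Acta Math. 111 (1964), Chap. III n° 37–39 pp. 187–190 (`𝐫_𝐀 = ⊗ 𝐫_v`, smooth vectors); [KudlaRallis1994] S. Kudla, S. Rallis, Ann. of Math. 140 (1994), §1 p. 8 (standard ∕ factorizable
sections); [GanQiuTakeda2014] W. T. Gan, Y. Qiu, S. Takeda, Invent. Math. 198 (2014), §6.3 (`⊗′_v R_n(V′_v)` spanned by `K`-finite pure tensors); [BorelJacquet1979] A. Borel,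
H. Jacquet, PSPM 33.1 (1979), §4.1; [Tan1999] V. Tan, §1 p. 166.
-/

set_option autoImplicit false
set_option linter.dupNamespace false
set_option Elab.async false

noncomputable section

open scoped Matrix TensorProduct SchwartzMap Classical
open NumberField NumberField.mixedEmbedding IsDedekindDomain

namespace Summit.HodgeConjecture.HodgeConjecture.Cruxes.HLiu418.K2LiuSWGeneratorKFinite

open Literature.NumberTheory.Automorphic Literature.NumberTheory.Automorphic.UnitaryGroup
open Literature.NumberTheory.GaloisRepresentations
open Literature.RepresentationTheory.HarrisKudlaSweet1996
open Literature.NumberTheory.GelbartRogawski1991 Literature.NumberTheory.GelbartRogawski1991.UnitaryDualPair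
open Literature.NumberTheory.GelbartRogawski1991.GRConstruction
open Literature.NumberTheory.Weil1964
open Literature.NumberTheory.K2Lit.SiegelDoubled
open Literature.NumberTheory.Automorphic.Liu2021.Def411WeilCarriersDoubling (doubledWeilRep isDoubledWeilRep_doubledWeilRep)
open Summit.HodgeConjecture.HodgeConjecture.Cruxes.HLiu418.K2LiuTensorEmbArchFinParts (finiteDimensional_span_orbit_of_mem_span_tmul_of_isStd)
open Summit.HodgeConjecture.HodgeConjecture.Cruxes.HLiu418.K2LiuRigidityDomainKFiniteConverse (exists_archStable_of_finiteDimensional_span_orbit)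

/-! ## §0 Generic linear algebra -/

section Generic

variable {K : Type*} [Field K] {V₁ V₂ : Type*} [AddCommGroup V₁] [Module K V₁] [AddCommGroup V₂] [Module K V₂]

/-- **a pure tensor with non-zero right factor remembers its left factor**: if `m ⊗ x` lies in the span of the pure tensors `w ⊗ y` with `w ∈ W` and `x ≠ 0`, then `m ∈ W`
(apply `1 ⊗ φ` for a functional `φ` with `φ x = 1`, Mathlib `Module.Projective.exists_dual_eq_one`, and `TensorProduct.rid`). [folklore] -/
theorem mem_of_tmul_mem_span_tmul (W : Submodule K V₁) {m : V₁} {x : V₂} (hx : x ≠ 0)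
    (h : m ⊗ₜ[K] x ∈ Submodule.span K {y : V₁ ⊗[K] V₂ | ∃ w ∈ W, ∃ z : V₂, y = w ⊗ₜ[K] z}) : m ∈ W := by
  obtain ⟨φ, hφ⟩ := Module.Projective.exists_dual_eq_one K hx
  -- `P := rid ∘ (1 ⊗ φ)` sends `w ⊗ z ↦ φ z • w` and `m ⊗ x ↦ m`
  let P : V₁ ⊗[K] V₂ →ₗ[K] V₁ := (TensorProduct.rid K V₁ : V₁ ⊗[K] K →ₗ[K] V₁) ∘ₗ LinearMap.lTensor V₁ φ
  have hP : ∀ (w : V₁) (z : V₂), P (w ⊗ₜ[K] z) = φ z • w := fun w z => by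
    simp only [P, LinearMap.coe_comp, Function.comp_apply, LinearMap.lTensor_tmul, LinearEquiv.coe_coe, TensorProduct.rid_tmul]
  have hle : Submodule.span K {y : V₁ ⊗[K] V₂ | ∃ w ∈ W, ∃ z : V₂, y = w ⊗ₜ[K] z} ≤ W.comap P := by
    refine Submodule.span_le.2 ?_
    rintro _ ⟨w, hw, z, rfl⟩
    simp only [SetLike.mem_coe, Submodule.mem_comap, hP]
    exact W.smul_mem _ hw
  have hm : P (m ⊗ₜ[K] x) ∈ W := hle h
  rwa [hP, hφ, one_smul] at hm

variable {M ι : Type*} [AddCommGroup M] [Module K M]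

/-- **the vectors with finite-dimensional orbit span form a subspace**: for ANY family `T_i` of linear endomorphisms, if every `x ∈ S` has finite-dimensional
`span{T_i x}`, so does every `x ∈ span S` (span induction; the orbit span of `x + y` lies in the sup of those of `x` and `y`). [folklore] -/
theorem finiteDimensional_span_range_of_mem_span (T : ι → M →ₗ[K] M) {S : Set M}
    (hS : ∀ x ∈ S, FiniteDimensional K (Submodule.span K (Set.range fun i => T i x))) {x : M} (hx : x ∈ Submodule.span K S) :
    FiniteDimensional K (Submodule.span K (Set.range fun i => T i x)) := by
  let O : M → Submodule K M := fun y => Submodule.span K (Set.range fun i => T i y)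
  change FiniteDimensional K (O x)
  induction hx using Submodule.span_induction with
  | mem y hy => exact hS y hy
  | zero =>
    refine Submodule.finiteDimensional_of_le (S₂ := ⊥) (Submodule.span_le.2 ?_)
    rintro _ ⟨i, rfl⟩
    simp only [map_zero, SetLike.mem_coe, Submodule.mem_bot]
  | add y z _ _ hy hz =>
    haveI := hy
    haveI := hz
    refine Submodule.finiteDimensional_of_le (S₂ := O y ⊔ O z) (Submodule.span_le.2 ?_)
    rintro _ ⟨i, rfl⟩
    simp only [map_add, SetLike.mem_coe]
    exact Submodule.add_mem_sup (Submodule.subset_span ⟨i, rfl⟩) (Submodule.subset_span ⟨i, rfl⟩)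
  | smul c y _ hy =>
    haveI := hy
    refine Submodule.finiteDimensional_of_le (S₂ := O y) (Submodule.span_le.2 ?_)
    rintro _ ⟨i, rfl⟩
    simp only [map_smul, SetLike.mem_coe]
    exact Submodule.smul_mem _ c (Submodule.subset_span ⟨i, rfl⟩)

end Generic

/-! ## §1 Currency (α): `_hΦ` for a pure tensor whose archimedean factor lies in a finite-dimensional arch-stable `V` -/

variable (L : Type) [Field L] [NumberField L] [IsCMField L]
variable {N M n : ℕ} (e : Fin N × Fin M ≃ Fin n)
  (dV : Fin N → L) (hdV : ∀ i, IsCMField.complexConj L (dV i) = dV i) (hdV0 : ∀ i, dV i ≠ 0)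
  (dW : Fin M → L) (hdW : ∀ i, IsCMField.complexConj L (dW i) = dW i) (hdW0 : ∀ i, dW i ≠ 0)
variable {M₂ M' n' : ℕ} (eW : Fin M × Fin M₂ ≃ Fin M') (e' : Fin N × Fin M' ≃ Fin n')
  (dV' : Fin M₂ → L) (hdV' : ∀ k, IsCMField.complexConj L (dV' k) = dV' k) (hdV'0 : ∀ k, dV' k ≠ 0)
variable {sB : HA L e' dV hdV (tensorFrame L dW eW dV') (tensorFrame_real L dW hdW eW dV' hdV') →*
    MpD L e' dV hdV (tensorFrame L dW eW dV') (tensorFrame_real L dW hdW eW dV' hdV')}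

set_option maxHeartbeats 2000000 in -- the big datum's carrier telescope
/-- **(S4-Kfin), currency (α) — `_hΦ` FOR A PURE TENSOR `E(Φ_∞ ⊗ Φ_f)`, ANY FINITE COMPONENT.**  `𝒦` a STANDARD Iwasawa datum of `H = U(𝔻)`, `s^B` ANY `χ_b`-normalised doubled Weil
representation of the big datum `(e′, dV, tensorFrame dW eW dV′)`, `V ≤ 𝓢((L⁺ ⊗ ℝ)^{n′+n′})` finite-dimensional and stabilised slot-wise by every purely archimedean `(a_∞, 1) ∈ 𝒦.K`
(`harch` of ★ `hV_of_arch`: `∀ a ∈ V, ∃ a′ ∈ V, ∀ f, ω(s^B((a_∞,1) ⊗ 1)) E(a ⊗ f) = E(a′ ⊗ f)`), `Φ_∞ ∈ V`.  Then for EVERY finite Schwartz–Bruhat function `Φ_f` the pure tensor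
`Φ = E(Φ_∞ ⊗ Φ_f)` has finite-dimensional `tensorEmb(𝒦.K)`-orbit span under `ω ∘ s^B` — #42S (a)'s `_hΦ` over `s^B` (★ U2f ⇒ `finiteDimensional_span_orbit_of_mem_span_tmul_of_isStd` at a
generator; the finite half is free). [cite: HarrisKudlaSweet1996, §1 (1.15)–(1.17)] [cite: KudlaRallis1994, §1 p. 8] [cite: Weil1964, Chap. III n° 37–39 pp. 187–190] [cite: Tan1999, §1 p. 166] -/
theorem finiteDimensional_span_orbit_tmul {𝒦 : IwasawaDatum L e dV hdV dW hdW} (h𝒦 : 𝒦.IsStd) {χb : HeckeCharacter L}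
    (hsB : IsDoubledWeilRep L e' dV hdV hdV0 (tensorFrame L dW eW dV') (tensorFrame_real L dW hdW eW dV' hdV')
      (tensorFrame_ne_zero L dW eW dV' hdW0 hdV'0) χb sB)
    (V : Submodule ℂ 𝓢(((Fin (n' + n')) → mixedSpace (Fp L)), ℂ)) [FiniteDimensional ℂ V]
    (harch : ∀ ainf : UnitaryGroup.arch (Fp L) L (IsCMField.complexConj L) (n + n) (hermD L e dV hdV dW hdW),
      (UnitaryGroup.archToAdelic (Fp L) L (IsCMField.complexConj L) (n + n) (hermD L e dV hdV dW hdW) ainf : HA L e dV hdV dW hdW) ∈ 𝒦.K →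
      ∀ a ∈ V, ∃ a' ∈ V, ∀ f : FinSB (Fp L) (Fin (n' + n')),
        adelicMpCont.omega (Fp L) (Fin (n' + n')) (gramDA L e' dV hdV (tensorFrame L dW eW dV') (tensorFrame_real L dW hdW eW dV' hdV'))
            (sB (tensorEmb L e dV hdV dW hdW eW e' dV' hdV'
              (UnitaryGroup.archToAdelic (Fp L) L (IsCMField.complexConj L) (n + n) (hermD L e dV hdV dW hdW) ainf)))
            (piSchwartzBruhatEquiv (Fp L) (Fin (n' + n')) (a ⊗ₜ[ℂ] f)) =
          piSchwartzBruhatEquiv (Fp L) (Fin (n' + n')) (a' ⊗ₜ[ℂ] f))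
    {Φinf : 𝓢(((Fin (n' + n')) → mixedSpace (Fp L)), ℂ)} (hΦinf : Φinf ∈ V) (Φf : FinSB (Fp L) (Fin (n' + n'))) :
    FiniteDimensional ℂ (Submodule.span ℂ (Set.range fun k : 𝒦.K =>
      adelicMpCont.omega (Fp L) (Fin (n' + n')) (gramDA L e' dV hdV (tensorFrame L dW eW dV') (tensorFrame_real L dW hdW eW dV' hdV'))
        (sB (tensorEmb L e dV hdV dW hdW eW e' dV' hdV' (k : HA L e dV hdV dW hdW)))
        (piSchwartzBruhatEquiv (Fp L) (Fin (n' + n')) (Φinf ⊗ₜ[ℂ] Φf)))) :=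
  finiteDimensional_span_orbit_of_mem_span_tmul_of_isStd L e dV hdV dW hdW eW e' dV' hdV' hdV0 hdW0 hdV'0 h𝒦 hsB V harch
    (Submodule.subset_span ⟨Φinf, hΦinf, Φf, rfl⟩)

set_option maxHeartbeats 2000000 in -- the big datum's carrier telescope
/-- **(S4-Kfin) for G7's restricted pure tensors** `Φ = E(Φ_∞ ⊗ ⊗_v Y_v)` (`Y : LocalSBFamily`, ★ `piProdSB`; the (S4-asm) datum `Y v = Φ_v` for `v ∈ S`, `Y v = 𝟙_v` for `v ∉ S`):
`_hΦ` over `s^B` from the arch datum `(V, harch, Φ_∞ ∈ V)` alone — the local components `Y v` are arbitrary. [cite: HarrisKudlaSweet1996, §1 (1.15)–(1.17)] [cite: Weil1964, Chap. III n° 37–39 pp. 187–190] -/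
theorem finiteDimensional_span_orbit_tmul_piProdSB {𝒦 : IwasawaDatum L e dV hdV dW hdW} (h𝒦 : 𝒦.IsStd) {χb : HeckeCharacter L}
    (hsB : IsDoubledWeilRep L e' dV hdV hdV0 (tensorFrame L dW eW dV') (tensorFrame_real L dW hdW eW dV' hdV')
      (tensorFrame_ne_zero L dW eW dV' hdW0 hdV'0) χb sB)
    (V : Submodule ℂ 𝓢(((Fin (n' + n')) → mixedSpace (Fp L)), ℂ)) [FiniteDimensional ℂ V]
    (harch : ∀ ainf : UnitaryGroup.arch (Fp L) L (IsCMField.complexConj L) (n + n) (hermD L e dV hdV dW hdW),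
      (UnitaryGroup.archToAdelic (Fp L) L (IsCMField.complexConj L) (n + n) (hermD L e dV hdV dW hdW) ainf : HA L e dV hdV dW hdW) ∈ 𝒦.K →
      ∀ a ∈ V, ∃ a' ∈ V, ∀ f : FinSB (Fp L) (Fin (n' + n')),
        adelicMpCont.omega (Fp L) (Fin (n' + n')) (gramDA L e' dV hdV (tensorFrame L dW eW dV') (tensorFrame_real L dW hdW eW dV' hdV'))
            (sB (tensorEmb L e dV hdV dW hdW eW e' dV' hdV'
              (UnitaryGroup.archToAdelic (Fp L) L (IsCMField.complexConj L) (n + n) (hermD L e dV hdV dW hdW) ainf)))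
            (piSchwartzBruhatEquiv (Fp L) (Fin (n' + n')) (a ⊗ₜ[ℂ] f)) =
          piSchwartzBruhatEquiv (Fp L) (Fin (n' + n')) (a' ⊗ₜ[ℂ] f))
    {Φinf : 𝓢(((Fin (n' + n')) → mixedSpace (Fp L)), ℂ)} (hΦinf : Φinf ∈ V) (Y : LocalSBFamily (Fp L) (Fin (n' + n'))) :
    FiniteDimensional ℂ (Submodule.span ℂ (Set.range fun k : 𝒦.K =>
      adelicMpCont.omega (Fp L) (Fin (n' + n')) (gramDA L e' dV hdV (tensorFrame L dW eW dV') (tensorFrame_real L dW hdW eW dV' hdV'))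
        (sB (tensorEmb L e dV hdV dW hdW eW e' dV' hdV' (k : HA L e dV hdV dW hdW)))
        (piSchwartzBruhatEquiv (Fp L) (Fin (n' + n')) (Φinf ⊗ₜ[ℂ] piProdSB (Fp L) (Fin (n' + n')) Y)))) :=
  finiteDimensional_span_orbit_tmul L e dV hdV hdV0 dW hdW hdW0 eW e' dV' hdV' hdV'0 h𝒦 hsB V harch hΦinf _

set_option maxHeartbeats 2000000 in -- the big datum's carrier telescope
/-- **(S4-Kfin), currency (α), THE BYTES OF U6 :884** (`s^B := doubledWeilRep … χ_b hχbu hχbs`, ★ `isDoubledWeilRep_doubledWeilRep`): for `χ_b` unitary with `IsSplittingChar L 1 χ_b`, a STANDARD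
`𝒦`, an arch datum `(V, harch, Φ_∞ ∈ V)` and ANY `Φ_f`, the pure tensor `E(Φ_∞ ⊗ Φ_f)` satisfies #42S (a)'s `_hΦ` token for token (the index `i` applied).
[cite: HarrisKudlaSweet1996, §1 (1.15)–(1.17)] [cite: KudlaRallis1994, §1 p. 8] [cite: Tan1999, §1 p. 166] -/
theorem finiteDimensional_span_orbit_tmul_doubledWeilRep {𝒦 : IwasawaDatum L e dV hdV dW hdW} (h𝒦 : 𝒦.IsStd)
    (χb : HeckeCharacter L) (hχbu : χb.IsUnitary) (hχbs : IsSplittingChar L 1 χb)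
    (V : Submodule ℂ 𝓢(((Fin (n' + n')) → mixedSpace (Fp L)), ℂ)) [FiniteDimensional ℂ V]
    (harch : ∀ ainf : UnitaryGroup.arch (Fp L) L (IsCMField.complexConj L) (n + n) (hermD L e dV hdV dW hdW),
      (UnitaryGroup.archToAdelic (Fp L) L (IsCMField.complexConj L) (n + n) (hermD L e dV hdV dW hdW) ainf : HA L e dV hdV dW hdW) ∈ 𝒦.K →
      ∀ a ∈ V, ∃ a' ∈ V, ∀ f : FinSB (Fp L) (Fin (n' + n')),
        adelicMpCont.omega (Fp L) (Fin (n' + n')) (gramDA L e' dV hdV (tensorFrame L dW eW dV') (tensorFrame_real L dW hdW eW dV' hdV'))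
            (doubledWeilRep L e' dV hdV hdV0 (tensorFrame L dW eW dV') (tensorFrame_real L dW hdW eW dV' hdV')
                (tensorFrame_ne_zero L dW eW dV' hdW0 hdV'0) χb hχbu hχbs
              (tensorEmb L e dV hdV dW hdW eW e' dV' hdV'
                (UnitaryGroup.archToAdelic (Fp L) L (IsCMField.complexConj L) (n + n) (hermD L e dV hdV dW hdW) ainf)))
            (piSchwartzBruhatEquiv (Fp L) (Fin (n' + n')) (a ⊗ₜ[ℂ] f)) =
          piSchwartzBruhatEquiv (Fp L) (Fin (n' + n')) (a' ⊗ₜ[ℂ] f))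
    {Φinf : 𝓢(((Fin (n' + n')) → mixedSpace (Fp L)), ℂ)} (hΦinf : Φinf ∈ V) (Φf : FinSB (Fp L) (Fin (n' + n'))) :
    FiniteDimensional ℂ (Submodule.span ℂ (Set.range fun k : 𝒦.K =>
      adelicMpCont.omega (Fp L) (Fin (n' + n')) (gramDA L e' dV hdV (tensorFrame L dW eW dV') (tensorFrame_real L dW hdW eW dV' hdV'))
        ((doubledWeilRep L e' dV hdV hdV0 (tensorFrame L dW eW dV') (tensorFrame_real L dW hdW eW dV' hdV')
            (tensorFrame_ne_zero L dW eW dV' hdW0 hdV'0) χb hχbu hχbs)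
          (tensorEmb L e dV hdV dW hdW eW e' dV' hdV' (k : HA L e dV hdV dW hdW)))
        (piSchwartzBruhatEquiv (Fp L) (Fin (n' + n')) (Φinf ⊗ₜ[ℂ] Φf)))) :=
  finiteDimensional_span_orbit_tmul L e dV hdV hdV0 dW hdW hdW0 eW e' dV' hdV' hdV'0 h𝒦
    (isDoubledWeilRep_doubledWeilRep L e' dV hdV hdV0 (tensorFrame L dW eW dV') (tensorFrame_real L dW hdW eW dV' hdV')
      (tensorFrame_ne_zero L dW eW dV' hdW0 hdV'0) χb hχbu hχbs) V harch hΦinf Φf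

/-! ## §2 Currency (γ): ONE pure tensor `E(Φ_∞ ⊗ f₀)` with `f₀ ≠ 0` certifies the archimedean factor -/

set_option maxHeartbeats 4000000 in -- the big datum's carrier telescope
/-- **`_hΦ` OF ONE PURE TENSOR PINS AN ARCH-STABLE FINITE-DIMENSIONAL `V ∋ Φ_∞`.**  `𝒦` ANY Iwasawa datum of `H = U(𝔻)` (no `IsStd`), `χ_b` unitary with `IsSplittingChar L 1 χ_b`, `s^B` ANY
`χ_b`-normalised doubled Weil representation of the big datum.  If the pure tensor `E(Φ_∞ ⊗ f₀)` with `f₀ ≠ 0` has finite-dimensional `tensorEmb(𝒦.K)`-orbit span under `ω ∘ s^B`, then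
`Φ_∞ ∈ V` for a finite-dimensional `V ≤ 𝓢((L⁺ ⊗ ℝ)^{n′+n′})` stabilised slot-wise by every purely archimedean `(a_∞, 1) ∈ 𝒦.K` (★ U2f ⇐ `exists_archStable_of_finiteDimensional_span_orbit`
gives `V` with `E(Φ_∞ ⊗ f₀) ∈ E(V ⊗ 𝒮_f)`; §0 `mem_of_tmul_mem_span_tmul` reads off `Φ_∞ ∈ V` since `f₀ ≠ 0`).
[cite: HarrisKudlaSweet1996, §1 (1.15)–(1.17)] [cite: Weil1964, Chap. III n° 37–38 pp. 188–190] [cite: BorelJacquet1979, §4.1] -/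
theorem exists_archStable_mem_of_finiteDimensional_span_orbit_tmul
    (𝒦 : IwasawaDatum L e dV hdV dW hdW) {χb : HeckeCharacter L} (hχbu : χb.IsUnitary) (hχbs : IsSplittingChar L 1 χb)
    (hsB : IsDoubledWeilRep L e' dV hdV hdV0 (tensorFrame L dW eW dV') (tensorFrame_real L dW hdW eW dV' hdV')
      (tensorFrame_ne_zero L dW eW dV' hdW0 hdV'0) χb sB)
    (Φinf : 𝓢(((Fin (n' + n')) → mixedSpace (Fp L)), ℂ)) {f₀ : FinSB (Fp L) (Fin (n' + n'))} (hf₀ : f₀ ≠ 0)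
    (hΦ : FiniteDimensional ℂ (Submodule.span ℂ (Set.range fun k : 𝒦.K =>
      adelicMpCont.omega (Fp L) (Fin (n' + n')) (gramDA L e' dV hdV (tensorFrame L dW eW dV') (tensorFrame_real L dW hdW eW dV' hdV'))
        (sB (tensorEmb L e dV hdV dW hdW eW e' dV' hdV' (k : HA L e dV hdV dW hdW)))
        (piSchwartzBruhatEquiv (Fp L) (Fin (n' + n')) (Φinf ⊗ₜ[ℂ] f₀))))) :
    ∃ V : Submodule ℂ 𝓢(((Fin (n' + n')) → mixedSpace (Fp L)), ℂ), FiniteDimensional ℂ V ∧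
      (∀ ainf : UnitaryGroup.arch (Fp L) L (IsCMField.complexConj L) (n + n) (hermD L e dV hdV dW hdW),
        (UnitaryGroup.archToAdelic (Fp L) L (IsCMField.complexConj L) (n + n) (hermD L e dV hdV dW hdW) ainf : HA L e dV hdV dW hdW) ∈ 𝒦.K →
        ∀ a ∈ V, ∃ a' ∈ V, ∀ f : FinSB (Fp L) (Fin (n' + n')),
          adelicMpCont.omega (Fp L) (Fin (n' + n')) (gramDA L e' dV hdV (tensorFrame L dW eW dV') (tensorFrame_real L dW hdW eW dV' hdV'))
              (sB (tensorEmb L e dV hdV dW hdW eW e' dV' hdV'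
                (UnitaryGroup.archToAdelic (Fp L) L (IsCMField.complexConj L) (n + n) (hermD L e dV hdV dW hdW) ainf)))
              (piSchwartzBruhatEquiv (Fp L) (Fin (n' + n')) (a ⊗ₜ[ℂ] f)) =
            piSchwartzBruhatEquiv (Fp L) (Fin (n' + n')) (a' ⊗ₜ[ℂ] f)) ∧
      Φinf ∈ V := by
  obtain ⟨V, hVfd, hVst, hmem⟩ := exists_archStable_of_finiteDimensional_span_orbit L e dV hdV hdV0 dW hdW hdW0 eW e' dV' hdV' hdV'0 𝒦 hχbu hχbs hsB
    (piSchwartzBruhatEquiv (Fp L) (Fin (n' + n')) (Φinf ⊗ₜ[ℂ] f₀)) hΦ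
  refine ⟨V, hVfd, hVst, mem_of_tmul_mem_span_tmul V hf₀ ?_⟩
  -- pull `E(Φ_∞ ⊗ f₀) ∈ span{E(a ⊗ f) : a ∈ V}` back along the linear equivalence `E`
  let E := piSchwartzBruhatEquiv (Fp L) (Fin (n' + n'))
  have hpull : ∀ u ∈ Submodule.span ℂ {x : piSchwartzBruhat (Fp L) (Fin (n' + n')) |
      ∃ a ∈ V, ∃ f : FinSB (Fp L) (Fin (n' + n')), x = piSchwartzBruhatEquiv (Fp L) (Fin (n' + n')) (a ⊗ₜ[ℂ] f)},
      E.symm u ∈ Submodule.span ℂ {y : 𝓢(((Fin (n' + n')) → mixedSpace (Fp L)), ℂ) ⊗[ℂ] FinSB (Fp L) (Fin (n' + n')) |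
        ∃ w ∈ V, ∃ z : FinSB (Fp L) (Fin (n' + n')), y = w ⊗ₜ[ℂ] z} := by
    intro u hu
    induction hu using Submodule.span_induction with
    | mem u hu =>
      obtain ⟨a, ha, f, rfl⟩ := hu
      rw [LinearEquiv.symm_apply_apply]
      exact Submodule.subset_span ⟨a, ha, f, rfl⟩
    | zero => rw [map_zero]; exact Submodule.zero_mem _
    | add x y _ _ hx hy => rw [map_add]; exact Submodule.add_mem _ hx hy
    | smul r x _ hx => rw [map_smul]; exact Submodule.smul_mem _ r hx
  have h := hpull _ hmem
  rwa [LinearEquiv.symm_apply_apply] at h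

set_option maxHeartbeats 4000000 in -- the big datum's carrier telescope
/-- **(S4-Kfin), currency (γ) — `K`-FINITENESS OF A PURE TENSOR SEES ONLY ITS ARCHIMEDEAN FACTOR.**  For a STANDARD `𝒦`, `χ_b` unitary with `IsSplittingChar L 1 χ_b` and ANY `χ_b`-normalised
`s^B`: if ONE pure tensor `E(Φ_∞ ⊗ f₀)` with `f₀ ≠ 0` satisfies #42S (a)'s `_hΦ`, then so does `E(Φ_∞ ⊗ Φ_f)` for EVERY finite Schwartz–Bruhat function `Φ_f` (the previous theorem, then §1).
One finite test function certifies all finite components the assembler may need. [cite: HarrisKudlaSweet1996, §1 (1.15)–(1.17)] [cite: KudlaRallis1994, §1 p. 8] [cite: Weil1964, Chap. III n° 37–39 pp. 187–190] -/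
theorem finiteDimensional_span_orbit_tmul_of_tmul {𝒦 : IwasawaDatum L e dV hdV dW hdW} (h𝒦 : 𝒦.IsStd)
    {χb : HeckeCharacter L} (hχbu : χb.IsUnitary) (hχbs : IsSplittingChar L 1 χb)
    (hsB : IsDoubledWeilRep L e' dV hdV hdV0 (tensorFrame L dW eW dV') (tensorFrame_real L dW hdW eW dV' hdV')
      (tensorFrame_ne_zero L dW eW dV' hdW0 hdV'0) χb sB)
    (Φinf : 𝓢(((Fin (n' + n')) → mixedSpace (Fp L)), ℂ)) {f₀ : FinSB (Fp L) (Fin (n' + n'))} (hf₀ : f₀ ≠ 0)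
    (hΦ : FiniteDimensional ℂ (Submodule.span ℂ (Set.range fun k : 𝒦.K =>
      adelicMpCont.omega (Fp L) (Fin (n' + n')) (gramDA L e' dV hdV (tensorFrame L dW eW dV') (tensorFrame_real L dW hdW eW dV' hdV'))
        (sB (tensorEmb L e dV hdV dW hdW eW e' dV' hdV' (k : HA L e dV hdV dW hdW)))
        (piSchwartzBruhatEquiv (Fp L) (Fin (n' + n')) (Φinf ⊗ₜ[ℂ] f₀)))))
    (Φf : FinSB (Fp L) (Fin (n' + n'))) :
    FiniteDimensional ℂ (Submodule.span ℂ (Set.range fun k : 𝒦.K =>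
      adelicMpCont.omega (Fp L) (Fin (n' + n')) (gramDA L e' dV hdV (tensorFrame L dW eW dV') (tensorFrame_real L dW hdW eW dV' hdV'))
        (sB (tensorEmb L e dV hdV dW hdW eW e' dV' hdV' (k : HA L e dV hdV dW hdW)))
        (piSchwartzBruhatEquiv (Fp L) (Fin (n' + n')) (Φinf ⊗ₜ[ℂ] Φf)))) := by
  obtain ⟨V, hVfd, harch, hmem⟩ := exists_archStable_mem_of_finiteDimensional_span_orbit_tmul L e dV hdV hdV0 dW hdW hdW0 eW e' dV' hdV' hdV'0
    𝒦 hχbu hχbs hsB Φinf hf₀ hΦ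
  haveI := hVfd
  exact finiteDimensional_span_orbit_tmul L e dV hdV hdV0 dW hdW hdW0 eW e' dV' hdV' hdV'0 h𝒦 hsB V harch hmem Φf

set_option maxHeartbeats 4000000 in -- the big datum's carrier telescope
/-- **(S4-Kfin), currency (γ), THE BYTES OF U6 :884** (`s^B := doubledWeilRep … χ_b hχbu hχbs`): `_hΦ` for ONE pure tensor `E(Φ_∞ ⊗ f₀)`, `f₀ ≠ 0`, gives `_hΦ` for `E(Φ_∞ ⊗ Φ_f)` for every `Φ_f`,
token for token the binder of #42S (a). [cite: HarrisKudlaSweet1996, §1 (1.15)–(1.17)] [cite: KudlaRallis1994, §1 p. 8] -/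
theorem finiteDimensional_span_orbit_tmul_of_tmul_doubledWeilRep {𝒦 : IwasawaDatum L e dV hdV dW hdW} (h𝒦 : 𝒦.IsStd)
    (χb : HeckeCharacter L) (hχbu : χb.IsUnitary) (hχbs : IsSplittingChar L 1 χb)
    (Φinf : 𝓢(((Fin (n' + n')) → mixedSpace (Fp L)), ℂ)) {f₀ : FinSB (Fp L) (Fin (n' + n'))} (hf₀ : f₀ ≠ 0)
    (hΦ : FiniteDimensional ℂ (Submodule.span ℂ (Set.range fun k : 𝒦.K =>
      adelicMpCont.omega (Fp L) (Fin (n' + n')) (gramDA L e' dV hdV (tensorFrame L dW eW dV') (tensorFrame_real L dW hdW eW dV' hdV'))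
        ((doubledWeilRep L e' dV hdV hdV0 (tensorFrame L dW eW dV') (tensorFrame_real L dW hdW eW dV' hdV')
            (tensorFrame_ne_zero L dW eW dV' hdW0 hdV'0) χb hχbu hχbs)
          (tensorEmb L e dV hdV dW hdW eW e' dV' hdV' (k : HA L e dV hdV dW hdW)))
        (piSchwartzBruhatEquiv (Fp L) (Fin (n' + n')) (Φinf ⊗ₜ[ℂ] f₀)))))
    (Φf : FinSB (Fp L) (Fin (n' + n'))) :
    FiniteDimensional ℂ (Submodule.span ℂ (Set.range fun k : 𝒦.K =>
      adelicMpCont.omega (Fp L) (Fin (n' + n')) (gramDA L e' dV hdV (tensorFrame L dW eW dV') (tensorFrame_real L dW hdW eW dV' hdV'))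
        ((doubledWeilRep L e' dV hdV hdV0 (tensorFrame L dW eW dV') (tensorFrame_real L dW hdW eW dV' hdV')
            (tensorFrame_ne_zero L dW eW dV' hdW0 hdV'0) χb hχbu hχbs)
          (tensorEmb L e dV hdV dW hdW eW e' dV' hdV' (k : HA L e dV hdV dW hdW)))
        (piSchwartzBruhatEquiv (Fp L) (Fin (n' + n')) (Φinf ⊗ₜ[ℂ] Φf)))) :=
  finiteDimensional_span_orbit_tmul_of_tmul L e dV hdV hdV0 dW hdW hdW0 eW e' dV' hdV' hdV'0 h𝒦 hχbu hχbs
    (isDoubledWeilRep_doubledWeilRep L e' dV hdV hdV0 (tensorFrame L dW eW dV') (tensorFrame_real L dW hdW eW dV' hdV')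
      (tensorFrame_ne_zero L dW eW dV' hdW0 hdV'0) χb hχbu hχbs) Φinf hf₀ hΦ Φf

/-! ## §3 Closure: `_hΦ` holds on the span of any set on which it holds -/

set_option maxHeartbeats 2000000 in -- the big datum's carrier telescope
/-- **`_hΦ` IS A LINEAR CONDITION**: for ANY Iwasawa datum `𝒦` and ANY `s^B`, if every `Ψ ∈ S` has finite-dimensional `tensorEmb(𝒦.K)`-orbit span under `ω ∘ s^B`, so does every `Φ ∈ span S`
(§0 `finiteDimensional_span_range_of_mem_span` at `T k := ω(s^B(tensorEmb k))`) — the assembler may sum its generators freely. [cite: HarrisKudlaSweet1996, §1 (1.15)–(1.17)] [cite: Tan1999, §1 p. 166] -/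
theorem finiteDimensional_span_orbit_of_mem_span (𝒦 : IwasawaDatum L e dV hdV dW hdW) {S : Set (piSchwartzBruhat (Fp L) (Fin (n' + n')))}
    (hS : ∀ Ψ ∈ S, FiniteDimensional ℂ (Submodule.span ℂ (Set.range fun k : 𝒦.K =>
      adelicMpCont.omega (Fp L) (Fin (n' + n')) (gramDA L e' dV hdV (tensorFrame L dW eW dV') (tensorFrame_real L dW hdW eW dV' hdV'))
        (sB (tensorEmb L e dV hdV dW hdW eW e' dV' hdV' (k : HA L e dV hdV dW hdW))) Ψ)))
    {Φ : piSchwartzBruhat (Fp L) (Fin (n' + n'))} (hΦ : Φ ∈ Submodule.span ℂ S) :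
    FiniteDimensional ℂ (Submodule.span ℂ (Set.range fun k : 𝒦.K =>
      adelicMpCont.omega (Fp L) (Fin (n' + n')) (gramDA L e' dV hdV (tensorFrame L dW eW dV') (tensorFrame_real L dW hdW eW dV' hdV'))
        (sB (tensorEmb L e dV hdV dW hdW eW e' dV' hdV' (k : HA L e dV hdV dW hdW))) Φ)) :=
  finiteDimensional_span_range_of_mem_span
    (fun k : 𝒦.K => adelicMpCont.omega (Fp L) (Fin (n' + n')) (gramDA L e' dV hdV (tensorFrame L dW eW dV') (tensorFrame_real L dW hdW eW dV' hdV'))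
      (sB (tensorEmb L e dV hdV dW hdW eW e' dV' hdV' (k : HA L e dV hdV dW hdW)))) hS hΦ

end Summit.HodgeConjecture.HodgeConjecture.Cruxes.HLiu418.K2LiuSWGeneratorKFinite

end
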